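import Mathlib

/-!
# The weight `m² - 1` symmetrises the roll chain (solo-blind, PLATEAU (PL-2)/complement theorem, paper §24.95(9))

In the ideal chain the `O(P)` advection operator `iP·H` is block lower-triangular (rolls evolve
autonomously, streaks are forced by rolls — lift-up) and its roll block has the unequal hops
`H[r_m, r_{m+1}] = h (m+2)/(m+1)` (from above) and `H[r_{m+1}, r_m] = h (m-1)/m` (from below), the
long-wave Rayleigh operator of `U = 2h cos θ`.  The diagonal weight `w_m = m² - 1` makes it symmetric:
`w_m · h(m+2)/(m+1) = w_{m+1} · h(m-1)/m` for all `m ≥ 1`, and `w_1 = 0` — the weight degenerates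
exactly at the neutral `m = 1` roll, which the chain does not feed (`H[r_2, r_1] = 0`).  Hence
`E_r = Σ_{m ≥ 2} (m² - 1) |r_m|²` is invariant under the `O(P)` roll advection and is dissipated by
`K₀ m² ≥ 4K₀ > |a₀|`: the structural lever for an energy/averaging proof of the complement bound.
This file records the algebra.
-/

namespace Summit.AnomalousDissipation.AnomalousDissipation.Theorems

/-- The symmetrising weight of the roll chain. -/
def rollWeight (m : ℕ) : ℝ := (m : ℝ) ^ 2 - 1

/-- `w_1 = 0`: the neutral roll carries no weight. -/
theorem rollWeight_one : rollWeight 1 = 0 := by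
  simp [rollWeight]

/-- `w_m > 0` for `m ≥ 2`. -/
theorem rollWeight_pos {m : ℕ} (hm : 2 ≤ m) : 0 < rollWeight m := by
  unfold rollWeight
  have : (2 : ℝ) ≤ m := by exact_mod_cast hm
  nlinarith

/-- **Detailed balance**: `w_m · (h (m+2)/(m+1)) = w_{m+1} · (h (m-1)/m)` for `m ≥ 1`, i.e. the weighted
roll block `W H_rr` is symmetric. -/
theorem rollWeight_detailed_balance (h : ℝ) {m : ℕ} (hm : 1 ≤ m) :
    rollWeight m * (h * ((m : ℝ) + 2) / ((m : ℝ) + 1)) =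
      rollWeight (m + 1) * (h * ((m : ℝ) - 1) / (m : ℝ)) := by
  unfold rollWeight
  have hm0 : (m : ℝ) ≠ 0 := by
    have : (1 : ℝ) ≤ m := by exact_mod_cast hm
    positivity
  have hm1 : (m : ℝ) + 1 ≠ 0 := by positivity
  push_cast
  field_simp
  ring

/-- Consequence (skew-adjointness of the advection in the weighted pairing, stated entrywise): for real
sequences `r`, the weighted quadratic form of the hop terms telescopes —
`Σ_{m=1}^{M-1} [w_m r_m (h(m+2)/(m+1)) r_{m+1} - w_{m+1} r_{m+1} (h(m-1)/m) r_m] = 0`. -/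
theorem rollChain_weighted_skew (h : ℝ) (r : ℕ → ℝ) (M : ℕ) :
    ∑ m ∈ Finset.Ico 1 M, (rollWeight m * (h * ((m : ℝ) + 2) / ((m : ℝ) + 1)) * (r m * r (m + 1)) -
      rollWeight (m + 1) * (h * ((m : ℝ) - 1) / (m : ℝ)) * (r (m + 1) * r m)) = 0 := by
  apply Finset.sum_eq_zero
  intro m hm
  have hm1 : 1 ≤ m := (Finset.mem_Ico.mp hm).1
  rw [rollWeight_detailed_balance h hm1, mul_comm (r (m + 1)) (r m)]
  ring

end Summit.AnomalousDissipation.AnomalousDissipation.Theorems
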